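import Summits.HubbardSuperconductivity.HubbardSuperconductivity.Theorems.AnisotropyChordStiffnessDoobNetwork

/-!
# Route `AnisotropyChord` / H0 rotor rung: THE LOOP INEQUALITY on the Doob configuration network and the
# skeleton of the converse rung N⁻ «defect-winding loops ⇒ uniform twist stiffness»
# (port of theory seat `hubbard-h0-rotor-theory-1`, cycle 10, `Sketch10.lean` Parts G, G′, H, memo ROTOR-THEORY-10
# §141, §143; work-order v8)

* Part G (`…Stiffness.Loop`): an abstract finite conductance network (`energy`, `drive`, `resistance`,
  `IsCirculation`); Cauchy–Schwarz along a circulation `IsCirculation.drive_sq_le` and the multicommodity-flow /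
  canonical-path comparison **`loop_inequality`**: `Σ_i μ_i s(m_i)²/R(m_i) ≤ K · energy(g)` for every potential
  `g`, for any weighted family of circulations with congestion `≤ K`;
* Part G′ (`…Stiffness.Doob`): the configuration hop-network (`HopEdge`, `hopSrc`, `hopTgt`, `hopCond`, `hopDrive`),
  `windingEnergy_eq_energy` (the winding energy of `…StiffnessDoobNetwork` IS the network energy against the unit
  winding drive), `windingEnergy_loop_bound`, `windingEnergy_ge_of_windingLoops`;
* Part H: `congestion_of_multiplicity` and the **N⁻ SKELETON `windingEnergy_ge_of_simpleLoops`**: a finite family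
  of simple winding loops (edge weights in `[0,1]`, one winding of axis `j`, π-weighted resistance `π_i R(m_i) ≤ M`,
  at most `n₀` loops per hop-edge) gives `L² · Σ_i π_i ≤ n₀ M · W_j(a; g)` for every `g`.  The two combinatorial
  inputs of N⁻ (loop construction from good starters; multiplicity count) are the hypotheses `hloops` / `hmult`
  (work-order v9).
Typing/proof authority: theory seat `hubbard-h0-rotor-theory-1`, cycle 10.
-/

set_option linter.dupNamespace false

noncomputable section

open Matrix Complex Finset Filter Topology
open scoped ComplexConjugate
open Literature.MathematicalPhysics.QuantumLattice hiding torusPhase torusNorm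
open Literature.Probability.LatticeModels
open Summit.HubbardSuperconductivity.HubbardSuperconductivity.Theorems.AnisotropyChord.InsertionEntropy
  (torusPhase norm_torusPhase IsPerronSectorGroundAmplitude)
open Summit.HubbardSuperconductivity.HubbardSuperconductivity.Theorems.AnisotropyChord.Stiffness

/-! ## G. THE LOOP INEQUALITY (memo ROTOR-THEORY-10 §141) — first lemma of the converse rung N⁻

Abstract finite conductance network: directed edges `e : E` with endpoints `src e, tgt e : V`, conductances
`c e ≥ 0`, an edge drive `s e`; the energy of a potential `g : V → ℝ` is `Σ_e c_e (g(tgt e) − g(src e) − s_e)²`.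
A CIRCULATION `m ≥ 0` (zero divergence) is orthogonal to every gradient, so the drive it carries,
`s(m) = Σ m_e s_e`, is bounded by Cauchy–Schwarz: `s(m)² ≤ R(m) · Σ_e m_e c_e (dg − s)_e²`, `R(m) = Σ m_e / c_e`.
Summing a weighted family of circulations with CONGESTION `Σ_i μ_i m_i(e) ≤ K` at every edge gives
**`Σ_i μ_i s(m_i)²/R(m_i) ≤ K · energy(g)` for every `g`** (`loop_inequality`) — the multicommodity-flow /
canonical-path comparison (Diaconis–Saloff-Coste, Sinclair) applied to a winding cocycle instead of a
spectral gap; equivalently Thomson's principle with an explicit divergence-free test flow.  Specialised to the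
Doob configuration network (`windingEnergy_eq_energy`, `windingEnergy_loop_bound`) it is the engine of N⁻:
winding loops whose interior vertices are single-defect teleports of a configuration turn bounded teleportation
ratios into a `DoobWindingStiffness` floor, hence (S_tw) by §F. -/

namespace Summit.HubbardSuperconductivity.HubbardSuperconductivity.Theorems.AnisotropyChord.Stiffness.Loop

variable {V E : Type*} [Fintype E]

/-- Energy of the potential `g` against the drive `s` on the network `(src, tgt, c)`:
`Σ_e c_e (g(tgt e) − g(src e) − s_e)²`. [folklore] -/
def energy (src tgt : E → V) (c s : E → ℝ) (g : V → ℝ) : ℝ :=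
  ∑ e, c e * (g (tgt e) - g (src e) - s e) ^ 2

/-- Drive carried by the edge weights `m`: `Σ_e m_e s_e`. [folklore] -/
def drive (s m : E → ℝ) : ℝ := ∑ e, m e * s e

/-- Resistance of the edge weights `m`: `Σ_e m_e / c_e` (multiplicity-weighted series resistance). [folklore] -/
def resistance (c m : E → ℝ) : ℝ := ∑ e, m e / c e

/-- A CIRCULATION on the network: nonnegative edge weights with zero divergence at every vertex
(out-weight = in-weight).  Closed walks, cycles and their nonnegative mixtures are circulations. [folklore] -/
structure IsCirculation [Fintype V] [DecidableEq V] (src tgt : E → V) (m : E → ℝ) : Prop where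
  nonneg : ∀ e, 0 ≤ m e
  divFree : ∀ v, ∑ e ∈ univ.filter (fun e => src e = v), m e = ∑ e ∈ univ.filter (fun e => tgt e = v), m e

section circ
variable [Fintype V] [DecidableEq V] {src tgt : E → V}

omit [Fintype E] in
/-- Fibrewise summation: `Σ_e m_e g(f e) = Σ_v g(v) Σ_{e : f e = v} m_e`. [folklore] -/
theorem sum_mul_apply_eq_fiber [Fintype E] (f : E → V) (m : E → ℝ) (g : V → ℝ) :
    ∑ e, m e * g (f e) = ∑ v, g v * ∑ e ∈ univ.filter (fun e => f e = v), m e := by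
  rw [← Finset.sum_fiberwise univ f (fun e => m e * g (f e))]
  refine sum_congr rfl fun v _ => ?_
  rw [mul_sum]
  refine sum_congr rfl fun e he => ?_
  rw [(mem_filter.1 he).2, mul_comm]

/-- A circulation is orthogonal to gradients: `Σ_e m_e (g(tgt e) − g(src e)) = 0`. [folklore] -/
theorem IsCirculation.sum_grad_eq_zero {m : E → ℝ} (hm : IsCirculation src tgt m) (g : V → ℝ) :
    ∑ e, m e * (g (tgt e) - g (src e)) = 0 := by
  simp only [mul_sub, sum_sub_distrib, sum_mul_apply_eq_fiber tgt m g, sum_mul_apply_eq_fiber src m g,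
    hm.divFree, sub_self]

/-- The drive carried by a circulation equals minus its pairing with any `dg − s`. [folklore] -/
theorem IsCirculation.drive_eq {m : E → ℝ} (hm : IsCirculation src tgt m) (s : E → ℝ) (g : V → ℝ) :
    drive s m = -∑ e, m e * (g (tgt e) - g (src e) - s e) := by
  have h := hm.sum_grad_eq_zero g
  unfold drive
  have : ∑ e, m e * (g (tgt e) - g (src e) - s e) = ∑ e, m e * (g (tgt e) - g (src e)) - ∑ e, m e * s e := by
    rw [← sum_sub_distrib]; exact sum_congr rfl fun e _ => by ring
  rw [this, h]; ring

/-- Resistance of nonnegative weights on edges of positive conductance is nonnegative. [folklore] -/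
theorem resistance_nonneg {c m : E → ℝ} (hm : ∀ e, 0 ≤ m e) (hc : ∀ e, 0 < m e → 0 < c e) :
    0 ≤ resistance c m := by
  refine sum_nonneg fun e _ => ?_
  rcases (hm e).eq_or_lt with h0 | hpos
  · rw [← h0]; simp
  · exact div_nonneg hpos.le (hc e hpos).le

/-- **Cauchy–Schwarz along a circulation:** `s(m)² ≤ R(m) · Σ_e m_e c_e (dg − s)_e²`. [folklore] -/
theorem IsCirculation.drive_sq_le {c s m : E → ℝ} (hm : IsCirculation src tgt m)
    (hc : ∀ e, 0 < m e → 0 < c e) (g : V → ℝ) :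
    drive s m ^ 2 ≤ resistance c m * ∑ e, m e * c e * (g (tgt e) - g (src e) - s e) ^ 2 := by
  rw [hm.drive_eq s g, neg_sq]
  set x : E → ℝ := fun e => g (tgt e) - g (src e) - s e with hx
  have key : ∀ e, Real.sqrt (m e / c e) * (Real.sqrt (m e * c e) * x e) = m e * x e := by
    intro e
    rcases (hm.nonneg e).eq_or_lt with h0 | hpos
    · rw [← h0]; simp
    · have hce := hc e hpos
      have hmc : m e / c e * (m e * c e) = m e * m e := by field_simp
      rw [← mul_assoc, ← Real.sqrt_mul (div_nonneg hpos.le hce.le), hmc, Real.sqrt_mul_self hpos.le]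
  have h1 : ∀ e, Real.sqrt (m e / c e) ^ 2 = m e / c e := by
    intro e
    rcases (hm.nonneg e).eq_or_lt with h0 | hpos
    · rw [← h0]; simp
    · exact Real.sq_sqrt (div_nonneg hpos.le (hc e hpos).le)
  have h2 : ∀ e, (Real.sqrt (m e * c e) * x e) ^ 2 = m e * c e * x e ^ 2 := by
    intro e
    rcases (hm.nonneg e).eq_or_lt with h0 | hpos
    · rw [← h0]; simp
    · rw [mul_pow, Real.sq_sqrt (mul_nonneg hpos.le (hc e hpos).le)]
  calc (∑ e, m e * (g (tgt e) - g (src e) - s e)) ^ 2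
      = (∑ e, Real.sqrt (m e / c e) * (Real.sqrt (m e * c e) * x e)) ^ 2 := by
        congr 1; exact sum_congr rfl fun e _ => (key e).symm
    _ ≤ (∑ e, Real.sqrt (m e / c e) ^ 2) * ∑ e, (Real.sqrt (m e * c e) * x e) ^ 2 :=
        sum_mul_sq_le_sq_mul_sq _ _ _
    _ = resistance c m * ∑ e, m e * c e * x e ^ 2 := by
        unfold resistance
        congr 1
        · exact sum_congr rfl fun e _ => h1 e
        · exact sum_congr rfl fun e _ => h2 e

/-- **THE LOOP INEQUALITY.** For a finite family of circulations `m_i` with weights `μ_i ≥ 0` on a network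
with conductances `c ≥ 0` (positive wherever some `m_i` is), and CONGESTION `Σ_i μ_i m_i(e) ≤ K` at every
edge: `Σ_i μ_i · s(m_i)²/R(m_i) ≤ K · energy(g)` for EVERY potential `g`.  (A circulation of zero resistance
contributes `0` by the division convention.) [new: theory seat hubbard-h0-rotor-theory-1, cycle 10, 2026-08-28] -/
theorem loop_inequality {ι : Type*} (S : Finset ι) {c s : E → ℝ} (hc0 : ∀ e, 0 ≤ c e)
    (m : ι → E → ℝ) (hm : ∀ i ∈ S, IsCirculation src tgt (m i))
    (hc : ∀ i ∈ S, ∀ e, 0 < m i e → 0 < c e) (μ : ι → ℝ) (hμ : ∀ i ∈ S, 0 ≤ μ i)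
    (K : ℝ) (hK : ∀ e, ∑ i ∈ S, μ i * m i e ≤ K) (g : V → ℝ) :
    ∑ i ∈ S, μ i * (drive s (m i) ^ 2 / resistance c (m i)) ≤ K * energy src tgt c s g := by
  set y : E → ℝ := fun e => (g (tgt e) - g (src e) - s e) ^ 2 with hy
  have hy0 : ∀ e, 0 ≤ y e := fun e => sq_nonneg _
  -- termwise: μ_i s(m_i)²/R(m_i) ≤ μ_i Σ_e m_i(e) c_e y_e
  have hterm : ∀ i ∈ S, μ i * (drive s (m i) ^ 2 / resistance c (m i))
      ≤ μ i * ∑ e, m i e * c e * y e := by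
    intro i hi
    refine mul_le_mul_of_nonneg_left ?_ (hμ i hi)
    have hX0 : 0 ≤ ∑ e, m i e * c e * y e :=
      sum_nonneg fun e _ => mul_nonneg (mul_nonneg ((hm i hi).nonneg e) (hc0 e)) (hy0 e)
    have hcs := (hm i hi).drive_sq_le (c := c) (s := s) (hc i hi) g
    rcases (resistance_nonneg (hm i hi).nonneg (hc i hi)).eq_or_lt with hR0 | hRpos
    · rw [← hR0, div_zero]; exact hX0
    · rw [div_le_iff₀ hRpos, mul_comm]; exact hcs
  calc ∑ i ∈ S, μ i * (drive s (m i) ^ 2 / resistance c (m i))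
      ≤ ∑ i ∈ S, μ i * ∑ e, m i e * c e * y e := sum_le_sum hterm
    _ = ∑ e, c e * y e * ∑ i ∈ S, μ i * m i e := by
        simp_rw [mul_sum]
        rw [sum_comm]
        exact sum_congr rfl fun e _ => sum_congr rfl fun i _ => by ring
    _ ≤ ∑ e, c e * y e * K :=
        sum_le_sum fun e _ => mul_le_mul_of_nonneg_left (hK e) (mul_nonneg (hc0 e) (hy0 e))
    _ = K * energy src tgt c s g := by
        unfold energy; rw [mul_sum]; exact sum_congr rfl fun e _ => by simp only [hy]; ring

end circ

end Summit.HubbardSuperconductivity.HubbardSuperconductivity.Theorems.AnisotropyChord.Stiffness.Loop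

/-! ## G′. The Doob configuration network as an instance: `windingEnergy = Loop.energy` -/

namespace Summit.HubbardSuperconductivity.HubbardSuperconductivity.Theorems.AnisotropyChord.Stiffness.Doob

variable {L : ℕ} [NeZero L]

/-- Directed hop-edges of the configuration network: a directed bond `(x, i)` (from `x` to `x + e_i`) together
with the configuration BEFORE the flip. [folklore] -/
abbrev HopEdge (L : ℕ) : Type := (TorusSite 2 L × Fin 2) × TensorIndex (TorusSite 2 L) 2

omit [NeZero L] in
/-- source configuration of a hop-edge. [folklore] -/
def hopSrc (e : HopEdge L) : TensorIndex (TorusSite 2 L) 2 := e.2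

/-- target configuration of a hop-edge: the flip across the bond. [folklore] -/
def hopTgt (e : HopEdge L) : TensorIndex (TorusSite 2 L) 2 :=
  e.2 ∘ Equiv.swap e.1.1 (e.1.1 + Pi.single e.1.2 1)

/-- Doob conductance of a hop-edge: `¼ a(σ) a(σ')` if the bond is flippable in `σ`, else `0`. [folklore] -/
def hopCond (a : TensorIndex (TorusSite 2 L) 2 → ℝ) (e : HopEdge L) : ℝ :=
  if e.2 e.1.1 ≠ e.2 (e.1.1 + Pi.single e.1.2 1) then (1 / 4 : ℝ) * (a e.2 * a (hopTgt e)) else 0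

/-- The unit winding drive of axis `j` on hop-edges: `[i = j] · orient`. [folklore] -/
def hopDrive (j : Fin 2) (e : HopEdge L) : ℝ :=
  (if e.1.2 = j then 1 else 0) * orient e.1.1 (e.1.1 + Pi.single e.1.2 1) e.2

omit [NeZero L] in
/-- Doob conductances are non-negative for a non-negative amplitude. [folklore] -/
theorem hopCond_nonneg {a : TensorIndex (TorusSite 2 L) 2 → ℝ} (ha : ∀ σ, 0 ≤ a σ) (e : HopEdge L) :
    0 ≤ hopCond a e := by
  unfold hopCond; split_ifs
  · exact mul_nonneg (by norm_num) (mul_nonneg (ha _) (ha _))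
  · exact le_rfl

/-- **The winding energy of §A is the network energy of the Doob hop-network against the winding drive.**
[folklore] -/
theorem windingEnergy_eq_energy (a : TensorIndex (TorusSite 2 L) 2 → ℝ) (j : Fin 2)
    (g : TensorIndex (TorusSite 2 L) 2 → ℝ) :
    windingEnergy a j g = Loop.energy hopSrc hopTgt (hopCond a) (hopDrive j) g := by
  rw [Loop.energy, Fintype.sum_prod_type]
  unfold windingEnergy bondWinding
  refine sum_congr rfl fun p _ => ?_
  rw [mul_sum]
  refine sum_congr rfl fun σ _ => ?_
  simp only [hopCond, hopTgt, hopSrc, hopDrive]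
  split_ifs <;> ring

/-- **Loop bound for the Doob winding energy (engine of N⁻).**  Any finite weighted family of circulations on
the configuration hop-network of a nonnegative amplitude `a` (positive on the edges they use), with congestion
`≤ K`, bounds the winding energy of EVERY potential from below:
`Σ_i μ_i s_j(m_i)²/R(m_i) ≤ K · W_j(a; g)`. [new: theory seat hubbard-h0-rotor-theory-1, cycle 10, 2026-08-28] -/
theorem windingEnergy_loop_bound {ι : Type*} (S : Finset ι) (a : TensorIndex (TorusSite 2 L) 2 → ℝ)
    (ha : ∀ σ, 0 ≤ a σ) (j : Fin 2) (m : ι → HopEdge L → ℝ)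
    (hm : ∀ i ∈ S, Loop.IsCirculation hopSrc hopTgt (m i))
    (hc : ∀ i ∈ S, ∀ e, 0 < m i e → 0 < hopCond a e) (μ : ι → ℝ) (hμ : ∀ i ∈ S, 0 ≤ μ i)
    (K : ℝ) (hK : ∀ e, ∑ i ∈ S, μ i * m i e ≤ K) (g : TensorIndex (TorusSite 2 L) 2 → ℝ) :
    ∑ i ∈ S, μ i * (Loop.drive (hopDrive j) (m i) ^ 2 / Loop.resistance (hopCond a) (m i))
      ≤ K * windingEnergy a j g := by
  rw [windingEnergy_eq_energy]
  exact Loop.loop_inequality S (hopCond_nonneg ha) m hm hc μ hμ K hK g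

/-- **Corollary (the shape used by N⁻).** If every circulation of the family carries drive `|s_j(m_i)| ≥ L`
(one winding) and the weights are `μ_i = π_i · R(m_i)` with `π_i ≥ 0` (so that `μ_i s²/R ≥ π_i L²`), then
`L² · Σ_i π_i ≤ K · W_j(a; g)`: a π-mass `Σ π_i ≥ θ N` of good loops with congestion `K ≤ C ℓ² B²` is a
`DoobWindingStiffness`-type floor. [new: theory seat hubbard-h0-rotor-theory-1, cycle 10, 2026-08-28] -/
theorem windingEnergy_ge_of_windingLoops {ι : Type*} (S : Finset ι) (a : TensorIndex (TorusSite 2 L) 2 → ℝ)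
    (ha : ∀ σ, 0 ≤ a σ) (j : Fin 2) (m : ι → HopEdge L → ℝ)
    (hm : ∀ i ∈ S, Loop.IsCirculation hopSrc hopTgt (m i))
    (hc : ∀ i ∈ S, ∀ e, 0 < m i e → 0 < hopCond a e) (π : ι → ℝ) (hπ : ∀ i ∈ S, 0 ≤ π i)
    (hwind : ∀ i ∈ S, (L : ℝ) ^ 2 ≤ Loop.drive (hopDrive j) (m i) ^ 2)
    (hres : ∀ i ∈ S, 0 < Loop.resistance (hopCond a) (m i))
    (K : ℝ) (hK : ∀ e, ∑ i ∈ S, π i * Loop.resistance (hopCond a) (m i) * m i e ≤ K)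
    (g : TensorIndex (TorusSite 2 L) 2 → ℝ) :
    (L : ℝ) ^ 2 * ∑ i ∈ S, π i ≤ K * windingEnergy a j g := by
  have h := windingEnergy_loop_bound S a ha j m hm hc (fun i => π i * Loop.resistance (hopCond a) (m i))
    (fun i hi => mul_nonneg (hπ i hi) (hres i hi).le) K hK g
  refine le_trans ?_ h
  rw [mul_sum]
  refine sum_le_sum fun i hi => ?_
  have hR := hres i hi
  calc (L : ℝ) ^ 2 * π i ≤ Loop.drive (hopDrive j) (m i) ^ 2 * π i :=
        mul_le_mul_of_nonneg_right (hwind i hi) (hπ i hi)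
    _ = π i * Loop.resistance (hopCond a) (m i) *
          (Loop.drive (hopDrive j) (m i) ^ 2 / Loop.resistance (hopCond a) (m i)) := by
        field_simp
    _ = _ := rfl

end Summit.HubbardSuperconductivity.HubbardSuperconductivity.Theorems.AnisotropyChord.Stiffness.Doob

/-! ## H. Typed shape of the converse rung N⁻ (memo §141): simple loop families, congestion from
multiplicity, and the target floor.  The two COMBINATORIAL STUBS left to the prover are recorded as the
hypotheses `hloops` / `hmult` of `windingEnergy_ge_of_simpleLoops` (construction of the winding defect loops
from good starters, and the ≤ n₀-loops-per-edge count); everything downstream is proved. -/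

namespace Summit.HubbardSuperconductivity.HubbardSuperconductivity.Theorems.AnisotropyChord.Stiffness.Doob

variable {L : ℕ} [NeZero L]

/-- Congestion from multiplicity: if every loop uses each hop-edge with weight in `[0,1]`, at most `n₀` loops
of the family use a given edge, and `π_i · R(m_i) ≤ M` for every loop, then the weighted congestion is
`≤ n₀ · M`. [folklore] -/
theorem congestion_of_multiplicity {ι : Type*} [DecidableEq ι] (S : Finset ι) (a : TensorIndex (TorusSite 2 L) 2 → ℝ)
    (m : ι → HopEdge L → ℝ) (π : ι → ℝ) (hπ : ∀ i ∈ S, 0 ≤ π i)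
    (hR : ∀ i ∈ S, 0 ≤ Loop.resistance (hopCond a) (m i))
    (h01 : ∀ i ∈ S, ∀ e, 0 ≤ m i e ∧ m i e ≤ 1) (M : ℝ) (hM0 : 0 ≤ M) (hM : ∀ i ∈ S, π i * Loop.resistance (hopCond a) (m i) ≤ M)
    (n₀ : ℕ) (hmult : ∀ e, (S.filter (fun i => m i e ≠ 0)).card ≤ n₀) (e : HopEdge L) :
    ∑ i ∈ S, π i * Loop.resistance (hopCond a) (m i) * m i e ≤ n₀ * M := by
  calc ∑ i ∈ S, π i * Loop.resistance (hopCond a) (m i) * m i e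
      = ∑ i ∈ S.filter (fun i => m i e ≠ 0), π i * Loop.resistance (hopCond a) (m i) * m i e := by
        rw [Finset.sum_filter]
        refine sum_congr rfl fun i _ => ?_
        by_cases h : m i e ≠ 0
        · simp [h]
        · push Not at h; simp [h]
    _ ≤ ∑ i ∈ S.filter (fun i => m i e ≠ 0), M := by
        refine sum_le_sum fun i hi => ?_
        have hiS := (mem_filter.1 hi).1
        calc π i * Loop.resistance (hopCond a) (m i) * m i e
            ≤ π i * Loop.resistance (hopCond a) (m i) * 1 :=
              mul_le_mul_of_nonneg_left (h01 i hiS e).2 (mul_nonneg (hπ i hiS) (hR i hiS))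
          _ ≤ M := by rw [mul_one]; exact hM i hiS
    _ = (S.filter (fun i => m i e ≠ 0)).card * M := by rw [sum_const, nsmul_eq_mul]
    _ ≤ n₀ * M := mul_le_mul_of_nonneg_right (by exact_mod_cast hmult e) hM0

/-- **N⁻ SKELETON (fixed `L`).**  A finite family of SIMPLE WINDING LOOPS on the Doob hop-network of a
nonnegative amplitude `a` — circulations with edge weights in `{0,1}`-range `[0,1]`, each carrying one winding
of axis `j` (`s_j(m_i)² ≥ L²`), each of π-weighted resistance `π_i R(m_i) ≤ M` (for the defect loops of memo
§141: `π_i = a(σ_i)²` and `M = 2(ℓ+2)B²` from the flatness of the one-defect amplitude profile along the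
cycle), at most `n₀` loops per hop-edge (`n₀ = 5(ℓ+2)` by the forced reconstruction of the starter from the
edge) — gives the floor **`L² · Σ_i π_i ≤ n₀ M · W_j(a; g)` for every potential `g`**.  With `Σ π_i ≥ θ N`
this is `W_j ≥ θ N L²/(n₀ M)`, i.e. `½Υ₀L²` with `Υ₀ = θρ/(5c_ℓ²B²)` when `ℓ + 2 ≤ c_ℓ L` — a
`DoobWindingStiffness` floor, hence (S_tw) by `variational_of_windingEnergy_ge`.  STUBS for the prover
(memo §141, work-order v9): `hloops` (build the circulations from GOOD STARTERS `(σ, P, C)` — `C` a winding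
cycle of empty sites of `σ∖P` drawn from a canonical disjoint family, interior vertices = single-defect
teleports `σ ∘ swap P c`) and `hmult` (≤ n₀ loops per edge). [new: theory seat hubbard-h0-rotor-theory-1, cycle 10, 2026-08-28] -/
theorem windingEnergy_ge_of_simpleLoops {ι : Type*} [DecidableEq ι] (S : Finset ι)
    (a : TensorIndex (TorusSite 2 L) 2 → ℝ) (ha : ∀ σ, 0 ≤ a σ) (j : Fin 2) (m : ι → HopEdge L → ℝ)
    (hloops : ∀ i ∈ S, Loop.IsCirculation hopSrc hopTgt (m i) ∧ (∀ e, 0 < m i e → 0 < hopCond a e) ∧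
      (∀ e, m i e ≤ 1) ∧ (L : ℝ) ^ 2 ≤ Loop.drive (hopDrive j) (m i) ^ 2 ∧
      0 < Loop.resistance (hopCond a) (m i))
    (π : ι → ℝ) (hπ : ∀ i ∈ S, 0 ≤ π i) (M : ℝ) (hM0 : 0 ≤ M)
    (hM : ∀ i ∈ S, π i * Loop.resistance (hopCond a) (m i) ≤ M)
    (n₀ : ℕ) (hmult : ∀ e, (S.filter (fun i => m i e ≠ 0)).card ≤ n₀)
    (g : TensorIndex (TorusSite 2 L) 2 → ℝ) :
    (L : ℝ) ^ 2 * ∑ i ∈ S, π i ≤ (n₀ * M) * windingEnergy a j g := by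
  refine windingEnergy_ge_of_windingLoops S a ha j m (fun i hi => (hloops i hi).1)
    (fun i hi => (hloops i hi).2.1) π hπ (fun i hi => (hloops i hi).2.2.2.1)
    (fun i hi => (hloops i hi).2.2.2.2) (n₀ * M) ?_ g
  intro e
  exact congestion_of_multiplicity S a m π hπ (fun i hi => (hloops i hi).2.2.2.2.le)
    (fun i hi e => ⟨(hloops i hi).1.nonneg e, (hloops i hi).2.2.1 e⟩) M hM0 hM n₀ hmult e

end Summit.HubbardSuperconductivity.HubbardSuperconductivity.Theorems.AnisotropyChord.Stiffness.Doob

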